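import Summits.QuantumFields.YangMills.Theorems.BalabanUVNodesN15CovariantSandwichLetters
import Summits.QuantumFields.YangMills.Theorems.BalabanUVNodesN15SmallFieldSiteLayerLive
import HarnessLib

/-!
# N15 = NE2 — PROGRAMME Q «COVARIANT AVERAGE IN THE SANDWICH», part (Q-3): ★★★ THE SITE LAYER OF dag-n15-c's LIVE FAMILY WITH A COVARIANTLY PERTURBED AVERAGING — `NE2PlusSite` BY NAME for
# the U-live site kernel whose sandwich averages with `Q⊗1 + D(A′)`, `Q*⊗1 + E(A′)` for ANY perturbation family of [B9] (3.81)'s size and an η-defect of rate `(L^k)^{−1∕16}` (rows DISPLAYED)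
# (dag-n15-a g31, FILE (Q-3); node N15 = NE2; `--supports stmt-QuantumFields-27366 --as helper`, count-neutral; one plumbing `def` + theorems; imports (Q-2), (J-c))

WHY.  [B9] Thm 3.2 (3.48) p.398 is the site-layer estimate for `(Q′(U)G′²(U)Q′*(U))⁻¹` with the COVARIANT averaging `Q′(U)`; (J-c) `ne2PlusSite_foSiteSf` proved the tree's site template for
dag-n15-c's live propagator sandwiched FLATLY (`Q ⊗ 1_colour`); §C p.406 (3.78)–(3.81): `Q(U) = Q(1) + F₂(A)`, `|F₂(A)B| ≤ O(1)·α₁·Q″|B|`.  This file proves the site template for the sandwich with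
`Q⊗1 + D`, `Q*⊗1 + E` for EVERY perturbation family `(D, E, D′, E′)` (index `i`, potential `A′`) whose block-majorant rows, under `Reg335 c₃₅ α₀ A′` in a small-field window `c₃₅L^mα₀ ≤ s₀`,
have (3.81)'s SIZE `K_D·(c₃₅L^mα₀)·e^{−ρd}` at both spacings and a two-grid COMPARISON along King's pairing `K_D·(L^k)^{−1∕16}·e^{−ρd}`, at EVERY rate `ρ > 0` (rate-dependent `K_D, s₀`).  The
family of n15-c∕181 (`qvCov T − Q⊗1` at the transporters of `e^{ηA′}`) is the intended instance (rows: n15-c∕182∕184∕185 by name); `NE2PlusSite` for it then follows from THIS theorem by `exact`.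

WHAT.  §1 def `foSiteCov … Dc Ec Df Ef i` (fine `siteC` at `zCovF A′ (Df i A′) (Ef i A′)` minus coarse `siteC` at `zCovC A′ (Dc i A′) (Ec i A′)`, read at the coloured unit bonds), `foSiteCov_ker`,
★ `foSiteCov_zero_family` (with the zero family it IS (J-c)'s `foSiteSf`), ★ `siteC_eq_inv_symPart_sandwich` (the honest dictionary for ANY sandwich `T`: `siteC M ι n b (unitBondMatC(T − (Q⊗1)(G⊗1)(Q*⊗1)))
= (Sym unitBondMatC T)⁻¹` — at `T = (Q⊗1 + D)X(Q*⊗1 + E)` the (3.48)-shaped object with the perturbed averaging, by (Q-2) `zCovC_eq`).  §2 ★★★ **`ne2PlusSite_foSiteCov`**: odd `L ≥ 7`,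
`a, c₃₅ > 0`, trace-form-orthonormal `e`, `ι` nonempty, a perturbation family with the displayed rows ⟹ `NE2PlusSite d′ p c₃₅ (sfInstance d mm ι hL) (foSiteCov d mm ι a e hL α β j j′ Dc Ec Df Ef)`
for all `α β j j′ d′ p` ((J-c)'s proof with (Q-2) `exists_zCov_letters` in place of (J-b′); thresholds: (J-c)'s plus `K_D c₃₅ a₀ ≤ K_D∕(K_D+1)` and the Combes–Thomas margin at `ζ = K(κ_e + 2K_D)r_A`).
§3 NON-VACUITY: ★ `rows_zeroFamily` (the zero family meets the displayed rows with `K_D = 0`), `ne2PlusSite_foSiteCov_zeroFamily` (§2 at that family — the flatly averaged site layer).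

HONEST FRAMING ∕ LIMITS.  The covariant averaging is MODELLED as `Q⊗1 + D` with `D`'s rows DISPLAYED ((3.81)'s shape) — the object `Q(U)` ([5] (124); n15-c∕181 `qvCov`, main term (125))
is NOT constructed or instantiated HERE; MODEL carriers of n15-c FILE 130∕133∕145 (global small-field gauge `u ≡ 1`; covariant Laplacian (3.50) ⊗ colour + FLAT nonlocal part (1.69) — not (3.26);
`Reg336` idle; King-block-mean pairing; doubled torus; `L ≥ 7`; `M₅ ≤ L^m` = print's «M ≥ M₁»; crude constants); the η-rate inequality itself is NOT PRINTED ([B9] Thm 3.14 = domain differences);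
(3.48) reads `G′²`, the model `X`.  NOT [B9] Thm 3.2 AS PRINTED.  No layer knit here; N15 stays DISCHARGED OF RECORD AS CONSUMED (U-blind v7 pin, p687738) — no re-pin asked, nothing re-claimed,
no count moved (typed 28∕28 · discharged 8∕28); K3⁸ OPEN; finite 𝕋⁴ per index — NOT ℝ⁴ ∕ OS ∕ mass gap ∕ Clay.  One plumbing `def` ⇒ review ∕ audit lane.  `set_option maxHeartbeats 800000 in` ×1
((J-c)'s budget).  No `sorry`, `instance`, `notation`; standard axioms.
[cite: Balaban1985BackgroundPropagators, Thm 3.2 (3.48) p.398 + (3.132) p.422 + Thm 3.14 pp.426–427 (quantifier template, shapes), (3.19) p.393, (3.78)–(3.81) p.406, (3.35) p.396; Balaban1985Averaging, (122)–(126) p.36 (NOT typed);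
Balaban1984PropagatorsI, (1.66) p.29, (1.102)–(1.103) p.34; King1986, Lemma 4.5 (4.38)–(4.41) pp.674–675 (mechanism); CombesThomas1973, §II (mechanism)]
-/

noncomputable section

open scoped BigOperators Matrix Matrix.Norms.Frobenius Kronecker

namespace Summit.QuantumFields.YangMills.BalabanUVNodes.N15.SiteLayerSf

open Literature.MathematicalPhysics.QuantumFieldTheory.Balaban1983to89
open Literature.MathematicalPhysics.QuantumFieldTheory.King1986 (exp_decay_mono)
open Literature.MathematicalPhysics.QuantumFieldTheory.Balaban1983to89.T4EtaRate (PairedInstance NE2PlusSite EtaRateIneqSite rateFactor)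
open Literature.MathematicalPhysics.QuantumFieldTheory.Balaban1983to89.T4EtaRateDefect (rateWeight)
open Literature.MathematicalPhysics.QuantumFieldTheory.Balaban1983to89.T4EtaRateCoeffDefect (pull)
open Literature.MathematicalPhysics.QuantumFieldTheory.Balaban1983to89.B11SectG (BlockNorm HasMaj)
open Literature.MathematicalPhysics.QuantumFieldTheory.Balaban1983to89.B5Prop11Plancherel (Tor fine)
open Literature.MathematicalPhysics.QuantumFieldTheory.Balaban1983to89.B6Lemma24Torus (pbox)
open Literature.MathematicalPhysics.QuantumFieldTheory.Balaban1983to89.B6BondEliminationTorus (pdist)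
open Literature.MathematicalPhysics.QuantumFieldTheory.Balaban1983to89.B6Cov2156Torus (deltaPol one_le_M)
open Literature.MathematicalPhysics.QuantumFieldTheory.Balaban1983to89.B6LowerBound2153Torus (rep rep_mem_pbox)
open Literature.MathematicalPhysics.QuantumFieldTheory.Balaban1983to89.B6UnitTorusCarrier (unitTorusGeo pdist_rep_rep)
open Literature.MathematicalPhysics.QuantumFieldTheory.King1986.Torus (blockOf tdistT tdistT_nonneg)
open Literature.Barriers.QuantumFields (traceForm)
open Summit.QuantumFields.YangMills.BalabanUVNodes.N15.OperatorReadout (opGeo)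
open Summit.QuantumFields.YangMills.BalabanUVNodes.N15.GenuineSite (etaRateIneqSite_opGeo_unit)
open Summit.QuantumFields.YangMills.BalabanUVNodes.N15.VectorPiece (bshiftEquiv kingPrV tensorId unitTorusGeoS rateWeight_unitTorusGeoS)
open Summit.QuantumFields.YangMills.BalabanUVNodes.N15.MatrixSpecies (basisConst basisConst_nonneg liftBlk liftMap)
open Summit.QuantumFields.YangMills.BalabanUVNodes.N15.UnitLayerBgCol (cdist cdist_eq cdist_nonneg siteC siteC_apply siteC_zero siteC_sub_letters unitBondMatC unitBondMatC_add unitBondMatC_tensorId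
  kron_one_isSymm inv_smul_one_add_deltaCol)
open Summit.QuantumFields.YangMills.BalabanUVNodes.N15.UnitLayerBg (sOp sOp_def exDress symPart symPart_apply unitBondMat_sOp_isSymm)
open Summit.QuantumFields.YangMills.BalabanUVNodes.N15.BackgroundLayer (gavgM)
open Summit.QuantumFields.YangMills.BalabanUVNodes.N15.TwoGrid (gOp qvRe qvAdjRe)
open Summit.QuantumFields.YangMills.BalabanUVNodes.N15.Gluing (SfIdx sfGeo sfInstance sfInstance_reg335_iff sfInstance_gf_M CvX CvX' cvM cvBlk CvNorm cvNL cvNL' cvGlued cvGlued')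
open Summit.QuantumFields.YangMills.BalabanUVNodes.N15.GluedZeroField (zCovC zCovF zCovC_zero_zero zCovF_zero_zero exists_zCov_letters)

variable (d : ℕ) {L : ℕ} [NeZero L] (mm ι : Type) [Fintype mm] [DecidableEq mm] [Fintype ι] [DecidableEq ι] (a : ℝ) (e : Matrix mm mm ℂ ≃L[ℝ] (ι → ℝ))

/-! ## §1 The U-live site kernel with a perturbed averaging; the honest dictionary -/

section Kernel

/-- ★ **THE U-LIVE SITE-LAYER η-DIFFERENCE KERNEL WITH A PERTURBED AVERAGING** on dag-n15-c's small-field family: for a perturbation family (`Dc, Ec` coarse, `Df, Ef` fine, indexed by the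
node index and the potential), `(A′, y, y′) ↦ siteC^{(L^rL^k)}(zCovF A′ (Df i A′) (Ef i A′))(pp,qq) − siteC^{(L^k)}(zCovC A′ (Dc i A′) (Ec i A′))(pp,qq)` at the coloured unit bonds `pp = ((ȳ,α),j)`,
`qq = ((ȳ′,β),j′)` — the (3.48)-shaped site objects with the averaging `Q⊗1 + D` (by `siteC_eq_inv_symPart_sandwich` + (Q-2) `zCovC_eq`). [cite: Balaban1985BackgroundPropagators, Thm 3.2 (3.48) p.398, (3.132) p.422, (3.78)–(3.81) p.406 (shapes)] -/
def foSiteCov (hL : Odd L ∧ 1 < L) (α β : Fin (d + 1)) (j j' : ι)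
    (Dc : ∀ i : SfIdx d L, (Fin (d + 1) → CvX' d L i.m i.kk i.r hL → Matrix mm mm ℂ) → ((CvX d L i.m i.kk hL × ι → ℝ) →ₗ[ℝ] ((Tor (cvM d L i.m i.kk hL) × Fin (d + 1)) × ι → ℝ)))
    (Ec : ∀ i : SfIdx d L, (Fin (d + 1) → CvX' d L i.m i.kk i.r hL → Matrix mm mm ℂ) → (((Tor (cvM d L i.m i.kk hL) × Fin (d + 1)) × ι → ℝ) →ₗ[ℝ] (CvX d L i.m i.kk hL × ι → ℝ)))
    (Df : ∀ i : SfIdx d L, (Fin (d + 1) → CvX' d L i.m i.kk i.r hL → Matrix mm mm ℂ) → ((CvX' d L i.m i.kk i.r hL × ι → ℝ) →ₗ[ℝ] ((Tor (cvM d L i.m i.kk hL) × Fin (d + 1)) × ι → ℝ)))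
    (Ef : ∀ i : SfIdx d L, (Fin (d + 1) → CvX' d L i.m i.kk i.r hL → Matrix mm mm ℂ) → (((Tor (cvM d L i.m i.kk hL) × Fin (d + 1)) × ι → ℝ) →ₗ[ℝ] (CvX' d L i.m i.kk i.r hL × ι → ℝ)))
    (i : SfIdx d L) : B9.SiteKernel (sfInstance d mm ι hL i).gc (sfInstance d mm ι hL i).Bf :=
  ⟨fun A' y y' =>
    siteC (cvM d L i.m i.kk hL) ι (L ^ i.r * L ^ i.kk) a (zCovF d mm ι a e hL i.m i.kk i.r A' (Df i A') (Ef i A'))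
        ((⟨rep (cvM d L i.m i.kk hL) y, rep_mem_pbox (cvM d L i.m i.kk hL) y⟩, α), j) ((⟨rep (cvM d L i.m i.kk hL) y', rep_mem_pbox (cvM d L i.m i.kk hL) y'⟩, β), j')
      - siteC (cvM d L i.m i.kk hL) ι (L ^ i.kk) a (zCovC d mm ι a e hL i.m i.kk i.r A' (Dc i A') (Ec i A'))
        ((⟨rep (cvM d L i.m i.kk hL) y, rep_mem_pbox (cvM d L i.m i.kk hL) y⟩, α), j) ((⟨rep (cvM d L i.m i.kk hL) y', rep_mem_pbox (cvM d L i.m i.kk hL) y'⟩, β), j')⟩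

/-- Unfolding of `foSiteCov`. [folklore] -/
theorem foSiteCov_ker (hL : Odd L ∧ 1 < L) (α β : Fin (d + 1)) (j j' : ι)
    (Dc : ∀ i : SfIdx d L, (Fin (d + 1) → CvX' d L i.m i.kk i.r hL → Matrix mm mm ℂ) → ((CvX d L i.m i.kk hL × ι → ℝ) →ₗ[ℝ] ((Tor (cvM d L i.m i.kk hL) × Fin (d + 1)) × ι → ℝ)))
    (Ec : ∀ i : SfIdx d L, (Fin (d + 1) → CvX' d L i.m i.kk i.r hL → Matrix mm mm ℂ) → (((Tor (cvM d L i.m i.kk hL) × Fin (d + 1)) × ι → ℝ) →ₗ[ℝ] (CvX d L i.m i.kk hL × ι → ℝ)))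
    (Df : ∀ i : SfIdx d L, (Fin (d + 1) → CvX' d L i.m i.kk i.r hL → Matrix mm mm ℂ) → ((CvX' d L i.m i.kk i.r hL × ι → ℝ) →ₗ[ℝ] ((Tor (cvM d L i.m i.kk hL) × Fin (d + 1)) × ι → ℝ)))
    (Ef : ∀ i : SfIdx d L, (Fin (d + 1) → CvX' d L i.m i.kk i.r hL → Matrix mm mm ℂ) → (((Tor (cvM d L i.m i.kk hL) × Fin (d + 1)) × ι → ℝ) →ₗ[ℝ] (CvX' d L i.m i.kk i.r hL × ι → ℝ)))
    (i : SfIdx d L) (A' : Fin (d + 1) → CvX' d L i.m i.kk i.r hL → Matrix mm mm ℂ) (y y' : Tor (cvM d L i.m i.kk hL)) :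
    (foSiteCov d mm ι a e hL α β j j' Dc Ec Df Ef i).ker A' y y' =
      siteC (cvM d L i.m i.kk hL) ι (L ^ i.r * L ^ i.kk) a (zCovF d mm ι a e hL i.m i.kk i.r A' (Df i A') (Ef i A'))
          ((⟨rep (cvM d L i.m i.kk hL) y, rep_mem_pbox (cvM d L i.m i.kk hL) y⟩, α), j) ((⟨rep (cvM d L i.m i.kk hL) y', rep_mem_pbox (cvM d L i.m i.kk hL) y'⟩, β), j')
        - siteC (cvM d L i.m i.kk hL) ι (L ^ i.kk) a (zCovC d mm ι a e hL i.m i.kk i.r A' (Dc i A') (Ec i A'))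
          ((⟨rep (cvM d L i.m i.kk hL) y, rep_mem_pbox (cvM d L i.m i.kk hL) y⟩, α), j) ((⟨rep (cvM d L i.m i.kk hL) y', rep_mem_pbox (cvM d L i.m i.kk hL) y'⟩, β), j') := rfl

/-- ★ **CONSISTENCY — WITH THE ZERO PERTURBATION FAMILY THE KERNEL IS (J-c)'s FLATLY AVERAGED `foSiteSf`** (pointwise, every index, potential and sites). [bookkeeping] -/
theorem foSiteCov_zero_family (hL : Odd L ∧ 1 < L) (α β : Fin (d + 1)) (j j' : ι) (i : SfIdx d L) (A' : Fin (d + 1) → CvX' d L i.m i.kk i.r hL → Matrix mm mm ℂ)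
    (y y' : Tor (cvM d L i.m i.kk hL)) :
    (foSiteCov d mm ι a e hL α β j j' (fun _ _ => 0) (fun _ _ => 0) (fun _ _ => 0) (fun _ _ => 0) i).ker A' y y' = (foSiteSf d mm ι a e hL α β j j' i).ker A' y y' := by
  rw [foSiteCov_ker, foSiteSf_ker, zCovC_zero_zero, zCovF_zero_zero]

variable {d mm ι a e} in
/-- ★ **THE HONEST DICTIONARY FOR ANY SANDWICH**: for ANY operator `T` on the coloured unit 1-forms (`n ≥ 1`, `b > 0`), `siteC M ι n b (unitBondMatC(T − (Q⊗1)∘(G⊗1)∘(Q*⊗1))) = (Sym unitBondMatC T)⁻¹` —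
(J-c′) `siteC_eq_inv_symPart` with the flat sandwich replaced by an arbitrary `T`; at `T = (Q⊗1 + D)∘X∘(Q*⊗1 + E)` ((Q-2) `zCovC_eq`) the coarse site object of `foSiteCov` IS the symmetrised INVERSE
of the covariantly averaged live propagator, Bałaban's `(Q(U)G(U)Q(U)*)⁻¹`-shaped object ((3.48) ∕ (3.132) shape; model level). [cite: Balaban1984PropagatorsI, (1.102)–(1.103) p.34; Balaban1985BackgroundPropagators, Thm 3.2 (3.48) p.398 (shape)] -/
theorem siteC_eq_inv_symPart_sandwich (M : Fin (d + 1) → ℕ) [∀ μ, NeZero (M μ)] (n : ℕ) [NeZero n] {b : ℝ} (hn : 1 ≤ n) (hb : 0 < b)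
    (T : ((Tor M × Fin (d + 1)) × ι → ℝ) →ₗ[ℝ] ((Tor M × Fin (d + 1)) × ι → ℝ)) :
    siteC M ι n b (unitBondMatC M ι (T - tensorId ι (qvRe M n) ∘ₗ tensorId ι (gOp M n b) ∘ₗ tensorId ι (qvAdjRe M n))) = (symPart (unitBondMatC M ι T))⁻¹ := by
  have hS : tensorId ι (qvRe M n) ∘ₗ tensorId ι (gOp M n b) ∘ₗ tensorId ι (qvAdjRe M n) = tensorId ι (sOp M n b) := by
    rw [sOp_def]; exact LinearMap.ext fun f => funext fun p => rfl
  have hsplit : T = tensorId ι (sOp M n b) + (T - tensorId ι (qvRe M n) ∘ₗ tensorId ι (gOp M n b) ∘ₗ tensorId ι (qvAdjRe M n)) := by rw [hS]; abel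
  have hsym : (unitBondMatC M ι (tensorId ι (sOp M n b))).IsSymm := by
    rw [unitBondMatC_tensorId]; exact kron_one_isSymm ι (unitBondMat_sOp_isSymm M n hn hb)
  have hsymPart : symPart (unitBondMatC M ι (tensorId ι (sOp M n b)) + unitBondMatC M ι (T - tensorId ι (qvRe M n) ∘ₗ tensorId ι (gOp M n b) ∘ₗ tensorId ι (qvAdjRe M n))) =
      unitBondMatC M ι (tensorId ι (sOp M n b)) + symPart (unitBondMatC M ι (T - tensorId ι (qvRe M n) ∘ₗ tensorId ι (gOp M n b) ∘ₗ tensorId ι (qvAdjRe M n))) := by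
    ext p q
    simp only [symPart_apply, Matrix.add_apply]
    rw [hsym.apply q p]
    ring
  conv_rhs => rw [hsplit, unitBondMatC_add, hsymPart]
  rw [siteC, exDress, inv_smul_one_add_deltaCol M ι n b hn hb, add_sub_cancel]

end Kernel

/-! ## §2 ★★★ `NE2PlusSite` by name for the covariantly averaged site kernel -/

section SiteLayer

set_option maxHeartbeats 800000 in
/-- ★★★ **`NE2PlusSite` — THE NODE's SECOND CONJUNCT BY NAME — FOR THE U-LIVE SITE KERNEL WITH A PERTURBED AVERAGING ON dag-n15-c's LIVE FAMILY.**  For odd `L ≥ 7`, `a, c₃₅ > 0`, a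
trace-form-orthonormal `e` (`ι` nonempty), directions `α β`, colours `j j′`, exponents `(d′, p)`, and a perturbation family `(Dc, Ec, Df, Ef)` with the DISPLAYED rows — for every rate `ρ > 0`
a constant `K_D ≥ 0` such that under `Reg335 c₃₅ α₀ A′` the four sizes are `≤ K_D·(c₃₅L^mα₀)·e^{−ρd}` ([B9] (3.81)'s shape) and the two comparison rows along King's pairing ⊗ 1_ι are
`≤ K_D·(L^k)^{−1∕16}·e^{−ρd}` —: `NE2PlusSite d′ p c₃₅ (sfInstance d mm ι hL) (foSiteCov d mm ι a e hL α β j j′ Dc Ec Df Ef)`.  Constants `(M₅, δ, a₀, C, γ) = (max(w₀,1), δ_S, a₀(e, K_D), C_S(K(2+2K_D)+1)+1,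
1∕16)`; mechanism = (J-c)'s with (Q-2) `exists_zCov_letters`.  MODEL objects; NOT [B9] Thm 3.2 as printed.
[cite: Balaban1985BackgroundPropagators, Thm 3.2 (3.48) p.398 + (3.132) p.422 + Thm 3.14 pp.426–427 (quantifier template, shapes), (3.78)–(3.81) p.406, (3.35) p.396; Balaban1984PropagatorsI, (1.66) p.29, (1.102)–(1.103) p.34; King1986, Lemma 4.5
(4.38)–(4.41) pp.674–675 (mechanism); CombesThomas1973, §II (mechanism)] -/
theorem ne2PlusSite_foSiteCov [Nonempty ι] (hL : Odd L ∧ 1 < L) (hL7 : 7 ≤ L) (ha : 0 < a) {c35 : ℝ} (hc35 : 0 < c35)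
    (he : ∀ A B : Matrix mm mm ℂ, traceForm A B = e A ⬝ᵥ e B) (α β : Fin (d + 1)) (j j' : ι) (d' : ℕ) (p : ℝ)
    (Dc : ∀ i : SfIdx d L, (Fin (d + 1) → CvX' d L i.m i.kk i.r hL → Matrix mm mm ℂ) → ((CvX d L i.m i.kk hL × ι → ℝ) →ₗ[ℝ] ((Tor (cvM d L i.m i.kk hL) × Fin (d + 1)) × ι → ℝ)))
    (Ec : ∀ i : SfIdx d L, (Fin (d + 1) → CvX' d L i.m i.kk i.r hL → Matrix mm mm ℂ) → (((Tor (cvM d L i.m i.kk hL) × Fin (d + 1)) × ι → ℝ) →ₗ[ℝ] (CvX d L i.m i.kk hL × ι → ℝ)))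
    (Df : ∀ i : SfIdx d L, (Fin (d + 1) → CvX' d L i.m i.kk i.r hL → Matrix mm mm ℂ) → ((CvX' d L i.m i.kk i.r hL × ι → ℝ) →ₗ[ℝ] ((Tor (cvM d L i.m i.kk hL) × Fin (d + 1)) × ι → ℝ)))
    (Ef : ∀ i : SfIdx d L, (Fin (d + 1) → CvX' d L i.m i.kk i.r hL → Matrix mm mm ℂ) → (((Tor (cvM d L i.m i.kk hL) × Fin (d + 1)) × ι → ℝ) →ₗ[ℝ] (CvX' d L i.m i.kk i.r hL × ι → ℝ)))
    (hfam : ∀ ρ : ℝ, 0 < ρ → ∃ KD s₀ : ℝ, 0 ≤ KD ∧ 0 < s₀ ∧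
      ∀ (i : SfIdx d L) (α₀ : ℝ) (A' : Fin (d + 1) → CvX' d L i.m i.kk i.r hL → Matrix mm mm ℂ), 0 < α₀ → c35 * (L : ℝ) ^ i.m * α₀ ≤ s₀ → (sfInstance d mm ι hL i).Bf.Reg335 c35 α₀ A' →
        HasMaj (CvNorm d L i.m i.kk hL ι) (BlockNorm.ofBlocks (unitTorusGeo L i.kk (cvM d L i.m i.kk hL)) (liftBlk (fun b : Tor (cvM d L i.m i.kk hL) × Fin (d + 1) => b.1) ι)) (Dc i A')
          (fun y y' => KD * (c35 * (L : ℝ) ^ i.m * α₀) * Real.exp (-(ρ * (unitTorusGeo L i.kk (cvM d L i.m i.kk hL)).dist y y'))) ∧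
        HasMaj (BlockNorm.ofBlocks (unitTorusGeo L i.kk (cvM d L i.m i.kk hL)) (liftBlk (fun b : CvX' d L i.m i.kk i.r hL => blockOf (L ^ i.r * L ^ i.kk) (cvM d L i.m i.kk hL) b.1) ι))
          (BlockNorm.ofBlocks (unitTorusGeo L i.kk (cvM d L i.m i.kk hL)) (liftBlk (fun b : Tor (cvM d L i.m i.kk hL) × Fin (d + 1) => b.1) ι)) (Df i A')
          (fun y y' => KD * (c35 * (L : ℝ) ^ i.m * α₀) * Real.exp (-(ρ * (unitTorusGeo L i.kk (cvM d L i.m i.kk hL)).dist y y'))) ∧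
        HasMaj (BlockNorm.ofBlocks (unitTorusGeo L i.kk (cvM d L i.m i.kk hL)) (liftBlk (fun b : Tor (cvM d L i.m i.kk hL) × Fin (d + 1) => b.1) ι)) (CvNorm d L i.m i.kk hL ι) (Ec i A')
          (fun y y' => KD * (c35 * (L : ℝ) ^ i.m * α₀) * Real.exp (-(ρ * (unitTorusGeo L i.kk (cvM d L i.m i.kk hL)).dist y y'))) ∧
        HasMaj (BlockNorm.ofBlocks (unitTorusGeo L i.kk (cvM d L i.m i.kk hL)) (liftBlk (fun b : Tor (cvM d L i.m i.kk hL) × Fin (d + 1) => b.1) ι))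
          (BlockNorm.ofBlocks (unitTorusGeo L i.kk (cvM d L i.m i.kk hL)) (liftBlk (fun b : CvX' d L i.m i.kk i.r hL => blockOf (L ^ i.r * L ^ i.kk) (cvM d L i.m i.kk hL) b.1) ι)) (Ef i A')
          (fun y y' => KD * (c35 * (L : ℝ) ^ i.m * α₀) * Real.exp (-(ρ * (unitTorusGeo L i.kk (cvM d L i.m i.kk hL)).dist y y'))) ∧
        HasMaj (CvNorm d L i.m i.kk hL ι) (BlockNorm.ofBlocks (unitTorusGeo L i.kk (cvM d L i.m i.kk hL)) (liftBlk (fun b : Tor (cvM d L i.m i.kk hL) × Fin (d + 1) => b.1) ι))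
          (Df i A' ∘ₗ pull (liftMap (kingPrV L i.kk i.r (cvM d L i.m i.kk hL)) ι) - Dc i A')
          (fun y y' => KD * ((((L ^ i.kk : ℕ) : ℝ)) ^ (-(1 / 16 : ℝ))) * Real.exp (-(ρ * (unitTorusGeo L i.kk (cvM d L i.m i.kk hL)).dist y y'))) ∧
        HasMaj (BlockNorm.ofBlocks (unitTorusGeo L i.kk (cvM d L i.m i.kk hL)) (liftBlk (fun b : Tor (cvM d L i.m i.kk hL) × Fin (d + 1) => b.1) ι))
          (BlockNorm.ofBlocks (unitTorusGeo L i.kk (cvM d L i.m i.kk hL)) (liftBlk (fun b : CvX' d L i.m i.kk i.r hL => blockOf (L ^ i.r * L ^ i.kk) (cvM d L i.m i.kk hL) b.1) ι))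
          (Ef i A' - pull (liftMap (kingPrV L i.kk i.r (cvM d L i.m i.kk hL)) ι) ∘ₗ Ec i A')
          (fun y y' => KD * ((((L ^ i.kk : ℕ) : ℝ)) ^ (-(1 / 16 : ℝ))) * Real.exp (-(ρ * (unitTorusGeo L i.kk (cvM d L i.m i.kk hL)).dist y y')))) :
    NE2PlusSite d' p c35 (sfInstance d mm ι hL) (foSiteCov d mm ι a e hL α β j j' Dc Ec Df Ef) := by
  have hLpos : 0 < L := Nat.pos_of_ne_zero (NeZero.ne L)
  have hLr : (0 : ℝ) < (L : ℝ) := Nat.cast_pos.mpr hLpos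
  have hL1 : (1 : ℝ) ≤ (L : ℝ) := by exact_mod_cast hLpos
  -- the three constant packages: (Q-2)'s letters (rate `ρ` for the family rows), the family's constant at that rate, (J-c′)'s site letter
  obtain ⟨ρ, δz, w₀, R₀, Kz, hρ, hδz, hR₀, hKz, HZ⟩ := exists_zCov_letters d mm ι a e hL hL7 ha
  obtain ⟨KD, s₀, hKD, hs₀, HD⟩ := hfam ρ hρ
  obtain ⟨C, δS, ζ₀, hC, hδS, hζ₀, HS⟩ := siteC_sub_letters d (Fintype.card ι) ha hδz
  -- the thresholds ((J-c)'s `σ, JJ, W, a_W, a_R, a_1` + the margins `a_ζ` at `ζ = K_Z(κ_e + 2K_D)r_A`, `a_D` for `K_D r_A ≤ 1`)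
  have hκ0 : 0 ≤ basisConst e := basisConst_nonneg e
  let σ : ℝ := 14 * Real.exp 1 * (1 + Fintype.card (Fin (d + 1))) * basisConst e * ((1 + Fintype.card (Fin (d + 1))) * (3 + 2 * ((d : ℝ) + 1)))
  have hσ0 : 0 ≤ σ := by positivity
  let JJ : ℝ := 1 + Fintype.card (Fin (d + 1) ⊕ Fin (d + 1))
  have hJJ0 : 0 ≤ JJ := by positivity
  let W : ℝ := 2 * ((1 + Fintype.card (Fin (d + 1))) * (3 + 2 * ((d : ℝ) + 1)))
  have hW0 : 0 < W := by positivity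
  let aW : ℝ := 1 / (W * c35)
  have haW : 0 < aW := by positivity
  let aR : ℝ := R₀ / (σ * c35 * JJ + 1)
  have haR : 0 < aR := by positivity
  let aζ : ℝ := ζ₀ / (Kz * (basisConst e + 2 * KD + 1) * c35)
  have haζ : 0 < aζ := by positivity
  let a1 : ℝ := 1 / ((basisConst e + 1) * c35)
  have ha1 : 0 < a1 := by positivity
  let aD : ℝ := 1 / ((KD + 1) * c35)
  have haD : 0 < aD := by positivity
  let aS : ℝ := s₀ / c35
  have haS0 : 0 < aS := by positivity
  let a₀ : ℝ := min (min (min (min aW aR) (min aζ a1)) aD) aS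
  have ha₀ : 0 < a₀ := lt_min (lt_min (lt_min (lt_min haW haR) (lt_min haζ ha1)) haD) haS0
  have ha₀W : a₀ ≤ aW := (((min_le_left _ _).trans (min_le_left _ _)).trans (min_le_left _ _)).trans (min_le_left _ _)
  have ha₀R : a₀ ≤ aR := (((min_le_left _ _).trans (min_le_left _ _)).trans (min_le_left _ _)).trans (min_le_right _ _)
  have ha₀ζ : a₀ ≤ aζ := (((min_le_left _ _).trans (min_le_left _ _)).trans (min_le_right _ _)).trans (min_le_left _ _)
  have ha₀1 : a₀ ≤ a1 := (((min_le_left _ _).trans (min_le_left _ _)).trans (min_le_right _ _)).trans (min_le_right _ _)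
  have ha₀D : a₀ ≤ aD := (min_le_left _ _).trans (min_le_right _ _)
  have ha₀S : a₀ ≤ aS := min_le_right _ _
  let M₁ : ℝ := max w₀ 1
  have hM₁ : 0 < M₁ := lt_of_lt_of_le one_pos (le_max_right _ _)
  refine ⟨M₁, δS, a₀, C * (Kz * (2 + 2 * KD) + 1) + 1, 1 / 16, hM₁, hδS, ha₀, by positivity, by norm_num, fun i hM α₀ hα₀ hMa A' hA' => ?_⟩
  -- the index's scalar facts
  rw [sfInstance_gf_M] at hM hMa
  have hw₀ : w₀ ≤ ((L ^ i.m : ℕ) : ℝ) := by push_cast; exact (le_max_left _ _).trans hM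
  have hx1 : (1 : ℝ) ≤ (L : ℝ) ^ i.kk := one_le_pow₀ hL1
  have hxpos : (0 : ℝ) < (L : ℝ) ^ i.kk := pow_pos hLr _
  have hcast : (((L ^ i.kk : ℕ) : ℝ)) = (L : ℝ) ^ i.kk := by push_cast; rfl
  have hLk : 1 ≤ L ^ i.kk := Nat.one_le_pow _ _ hLpos
  have hLrr : 1 ≤ L ^ i.r := Nat.one_le_pow _ _ hLpos
  set t : ℝ := ((L : ℝ) ^ i.kk) ^ (-(1 / 16 : ℝ)) with ht_def
  have ht0 : 0 ≤ t := Real.rpow_nonneg hxpos.le _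
  have hθt : (((L ^ i.kk : ℕ) : ℝ)) ^ (-(1 / 16 : ℝ)) = t := by rw [hcast]
  have hinv : ((((L ^ i.kk : ℕ) : ℝ)))⁻¹ ≤ t := by
    rw [hcast, ← Real.rpow_neg_one]; exact Real.rpow_le_rpow_of_exponent_le hx1 (by norm_num)
  have hη0 : 0 ≤ ((((L ^ i.kk : ℕ) : ℝ)))⁻¹ := by positivity
  have hθ0 : 0 ≤ (((L ^ i.kk : ℕ) : ℝ)) ^ (-(1 / 16 : ℝ)) := by rw [hθt]; exact ht0
  -- the class at the index: skewness and the C² window at scale `r_A = c₃₅L^mα₀`; the family's rows there (`r_A ≤ s₀` by the threshold)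
  have hrA0 : 0 ≤ c35 * (L : ℝ) ^ i.m * α₀ := by positivity
  have hrAa : c35 * (L : ℝ) ^ i.m * α₀ ≤ c35 * a₀ := by
    rw [mul_assoc]; exact mul_le_mul_of_nonneg_left hMa hc35.le
  have hrS : c35 * (L : ℝ) ^ i.m * α₀ ≤ s₀ := by
    calc c35 * (L : ℝ) ^ i.m * α₀ ≤ c35 * aS := hrAa.trans (mul_le_mul_of_nonneg_left ha₀S hc35.le)
      _ = s₀ := by
          show c35 * (s₀ / c35) = s₀
          field_simp
  obtain ⟨hDc, hDf, hEc, hEf, hDd, hEd⟩ := HD i α₀ A' hα₀ hrS hA'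
  obtain ⟨hskew, h1, h2, h3⟩ := (sfInstance_reg335_iff d mm ι hL i c35 α₀ A').1 hA'
  have hconv : ((L : ℝ) ^ i.kk)⁻¹ * ((L : ℝ) ^ i.r)⁻¹ = (((L ^ i.r * L ^ i.kk : ℕ) : ℝ))⁻¹ := by
    push_cast
    rw [mul_inv, mul_comm]
  have h2' : ∀ μ κ x', ‖A' μ (bshiftEquiv (cvM d L i.m i.kk hL) (L ^ i.r * L ^ i.kk) κ x') - A' μ x'‖ ≤ c35 * (L : ℝ) ^ i.m * α₀ * ((((L ^ i.r * L ^ i.kk : ℕ) : ℝ))⁻¹) :=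
    fun μ κ x' => (h2 μ κ x').trans_eq (by rw [hconv])
  have h3' : ∀ μ κ x', ‖(A' μ (bshiftEquiv (cvM d L i.m i.kk hL) (L ^ i.r * L ^ i.kk) κ x') - A' μ x') -
      (A' μ (bshiftEquiv (cvM d L i.m i.kk hL) (L ^ i.r * L ^ i.kk) κ ((bshiftEquiv (cvM d L i.m i.kk hL) (L ^ i.r * L ^ i.kk) μ).symm x')) -
        A' μ ((bshiftEquiv (cvM d L i.m i.kk hL) (L ^ i.r * L ^ i.kk) μ).symm x'))‖ ≤
      c35 * (L : ℝ) ^ i.m * α₀ * ((((L ^ i.r * L ^ i.kk : ℕ) : ℝ))⁻¹) * ((((L ^ i.r * L ^ i.kk : ℕ) : ℝ))⁻¹) :=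
    fun μ κ x' => (h3 μ κ x').trans_eq (by rw [hconv])
  have hr2 : 2 * ((1 + Fintype.card (Fin (d + 1))) * ((3 + 2 * ((d : ℝ) + 1)) * (c35 * (L : ℝ) ^ i.m * α₀))) ≤ 1 := by
    have hWa : W * (c35 * a₀) ≤ 1 := by
      calc W * (c35 * a₀) ≤ W * (c35 * aW) := mul_le_mul_of_nonneg_left (mul_le_mul_of_nonneg_left ha₀W hc35.le) hW0.le
        _ = 1 := by
          show W * (c35 * (1 / (W * c35))) = 1
          field_simp
    calc 2 * ((1 + Fintype.card (Fin (d + 1))) * ((3 + 2 * ((d : ℝ) + 1)) * (c35 * (L : ℝ) ^ i.m * α₀))) = W * (c35 * (L : ℝ) ^ i.m * α₀) := by ring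
      _ ≤ W * (c35 * a₀) := mul_le_mul_of_nonneg_left hrAa hW0.le
      _ ≤ 1 := hWa
  have hscale : 14 * Real.exp 1 * (1 + Fintype.card (Fin (d + 1))) * basisConst e * ((1 + Fintype.card (Fin (d + 1))) * ((3 + 2 * ((d : ℝ) + 1)) * (c35 * (L : ℝ) ^ i.m * α₀))) =
      σ * (c35 * (L : ℝ) ^ i.m * α₀) := by ring
  have hSle : σ * (c35 * (L : ℝ) ^ i.m * α₀) ≤ σ * (c35 * a₀) := mul_le_mul_of_nonneg_left hrAa hσ0
  have hRle : 14 * Real.exp 1 * (1 + Fintype.card (Fin (d + 1))) * basisConst e * ((1 + Fintype.card (Fin (d + 1))) * ((3 + 2 * ((d : ℝ) + 1)) * (c35 * (L : ℝ) ^ i.m * α₀))) *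
      (1 + Fintype.card (Fin (d + 1) ⊕ Fin (d + 1))) ≤ R₀ := by
    rw [hscale]
    have hRa : σ * (c35 * aR) * JJ ≤ R₀ := by
      have hden : 0 < σ * c35 * JJ + 1 := by positivity
      calc σ * (c35 * aR) * JJ = R₀ * (σ * c35 * JJ) / (σ * c35 * JJ + 1) := by
            show σ * (c35 * (R₀ / (σ * c35 * JJ + 1))) * JJ = R₀ * (σ * c35 * JJ) / (σ * c35 * JJ + 1)
            field_simp
        _ ≤ R₀ * (σ * c35 * JJ + 1) / (σ * c35 * JJ + 1) := by gcongr; linarith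
        _ = R₀ := by field_simp
    calc σ * (c35 * (L : ℝ) ^ i.m * α₀) * JJ ≤ σ * (c35 * a₀) * JJ := mul_le_mul_of_nonneg_right hSle hJJ0
      _ ≤ σ * (c35 * aR) * JJ := mul_le_mul_of_nonneg_right (mul_le_mul_of_nonneg_left (mul_le_mul_of_nonneg_left ha₀R hc35.le) hσ0) hJJ0
      _ ≤ R₀ := hRa
  -- the margins: `κ_e r_A ≤ 1`, `K_D r_A ≤ 1`, `K_Z(κ_e + 2K_D) r_A ≤ ζ₀`
  have hκr1 : basisConst e * (c35 * (L : ℝ) ^ i.m * α₀) ≤ 1 := by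
    calc basisConst e * (c35 * (L : ℝ) ^ i.m * α₀) ≤ (basisConst e + 1) * (c35 * a1) :=
          mul_le_mul (by linarith) (hrAa.trans (mul_le_mul_of_nonneg_left ha₀1 hc35.le)) hrA0 (by positivity)
      _ = 1 := by
          show (basisConst e + 1) * (c35 * (1 / ((basisConst e + 1) * c35))) = 1
          field_simp
  have hDr1 : KD * (c35 * (L : ℝ) ^ i.m * α₀) ≤ 1 := by
    calc KD * (c35 * (L : ℝ) ^ i.m * α₀) ≤ (KD + 1) * (c35 * aD) :=
          mul_le_mul (by linarith) (hrAa.trans (mul_le_mul_of_nonneg_left ha₀D hc35.le)) hrA0 (by positivity)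
      _ = 1 := by
          show (KD + 1) * (c35 * (1 / ((KD + 1) * c35))) = 1
          field_simp
  have hζle : Kz * (basisConst e * (c35 * (L : ℝ) ^ i.m * α₀) + KD * (c35 * (L : ℝ) ^ i.m * α₀) + KD * (c35 * (L : ℝ) ^ i.m * α₀)) ≤ ζ₀ := by
    have hre : Kz * (basisConst e * (c35 * (L : ℝ) ^ i.m * α₀) + KD * (c35 * (L : ℝ) ^ i.m * α₀) + KD * (c35 * (L : ℝ) ^ i.m * α₀)) =
        Kz * (basisConst e + 2 * KD) * (c35 * (L : ℝ) ^ i.m * α₀) := by ring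
    rw [hre]
    calc Kz * (basisConst e + 2 * KD) * (c35 * (L : ℝ) ^ i.m * α₀) ≤ Kz * (basisConst e + 2 * KD + 1) * (c35 * aζ) :=
          mul_le_mul (mul_le_mul_of_nonneg_left (by linarith) hKz.le) (hrAa.trans (mul_le_mul_of_nonneg_left ha₀ζ hc35.le)) hrA0 (by positivity)
      _ = ζ₀ := by
          show Kz * (basisConst e + 2 * KD + 1) * (c35 * (ζ₀ / (Kz * (basisConst e + 2 * KD + 1) * c35))) = ζ₀
          field_simp
  have hρD0 : 0 ≤ KD * (c35 * (L : ℝ) ^ i.m * α₀) := by positivity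
  have hτD0 : 0 ≤ KD * ((((L ^ i.kk : ℕ) : ℝ)) ^ (-(1 / 16 : ℝ))) := mul_nonneg hKD hθ0
  have hζ0 : 0 ≤ Kz * (basisConst e * (c35 * (L : ℝ) ^ i.m * α₀) + KD * (c35 * (L : ℝ) ^ i.m * α₀) + KD * (c35 * (L : ℝ) ^ i.m * α₀)) := by positivity
  have hτ0 : 0 ≤ Kz * ((((L ^ i.kk : ℕ) : ℝ)) ^ (-(1 / 16 : ℝ)) + basisConst e * (c35 * (L : ℝ) ^ i.m * α₀) * ((((L ^ i.kk : ℕ) : ℝ))⁻¹) +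
      KD * ((((L ^ i.kk : ℕ) : ℝ)) ^ (-(1 / 16 : ℝ))) + KD * ((((L ^ i.kk : ℕ) : ℝ)) ^ (-(1 / 16 : ℝ)))) := by positivity
  -- (Q-2): the three letters of the covariantly averaged matrices at this index, potential and family
  obtain ⟨hZ, hZ', hZZ⟩ := HZ i.m i.kk i.r i.one_le hw₀ he A' hskew (c35 * (L : ℝ) ^ i.m * α₀) hrA0 h1 h2' h3' hr2 hRle (Dc i A') (Ec i A') (Df i A') (Ef i A')
    (KD * (c35 * (L : ℝ) ^ i.m * α₀)) (KD * (c35 * (L : ℝ) ^ i.m * α₀)) (KD * ((((L ^ i.kk : ℕ) : ℝ)) ^ (-(1 / 16 : ℝ)))) (KD * ((((L ^ i.kk : ℕ) : ℝ)) ^ (-(1 / 16 : ℝ))))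
    hρD0 hDr1 hρD0 hDr1 hτD0 hτD0 hDc hDf hEc hEf hDd hEd
  -- (J-c′): the η-difference letter of the site objects
  have HSi := HS (cvM d L i.m i.kk hL) ι le_rfl (L ^ i.kk) (L ^ i.r * L ^ i.kk) (L ^ i.r) hLk hLrr rfl
    (zCovC d mm ι a e hL i.m i.kk i.r A' (Dc i A') (Ec i A')) (zCovF d mm ι a e hL i.m i.kk i.r A' (Df i A') (Ef i A')) _ _ hζ0 hζle hτ0 hZ hZ' hZZ
  -- the readout at unit sites
  have hη : (sfGeo d hL i).eta ≠ 0 := by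
    show ((L : ℝ) ^ i.kk)⁻¹ ≠ 0
    exact inv_ne_zero (pow_ne_zero _ hLr.ne')
  have hlen : ∀ y : (sfGeo d hL i).Site, (sfGeo d hL i).len y = 1 := fun y => by
    show (L : ℝ) ^ i.kk * ((L : ℝ) ^ i.kk)⁻¹ = 1
    exact mul_inv_cancel₀ (pow_ne_zero _ hLr.ne')
  refine etaRateIneqSite_opGeo_unit (g := sfGeo d hL i) (X := CvX d L i.m i.kk hL × ι) (blk := liftBlk (cvBlk d L i.m i.kk hL) ι)
    (foSiteCov d mm ι a e hL α β j j' Dc Ec Df Ef i) hlen hη hLr (fun y y' => ?_) d' p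
  rw [rateWeight_unitTorusGeoS, rateWeight_unitTorusGeoS, max_self, foSiteCov_ker,
    show (sfGeo d hL i).dist y y' = tdistT (cvM d L i.m i.kk hL) y y' from rfl]
  set M := cvM d L i.m i.kk hL with hMdef
  set pp : B4.Idx (pbox M) (d + 1) × ι := ((⟨rep M y, rep_mem_pbox M y⟩, α), j) with hpp
  set qq : B4.Idx (pbox M) (d + 1) × ι := ((⟨rep M y', rep_mem_pbox M y'⟩, β), j') with hqq
  have hcd : cdist M ι pp qq = tdistT M y y' := by
    rw [cdist_eq, hpp, hqq]
    exact pdist_rep_rep M (one_le_M M) y y'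
  have hS := HSi pp qq
  rw [hcd] at hS
  have hE := Real.exp_nonneg (-(δS * tdistT M y y'))
  -- the amplitude against `t = (L^k)^{−1∕16}`
  have hamp : C * (Kz * ((((L ^ i.kk : ℕ) : ℝ)) ^ (-(1 / 16 : ℝ)) + basisConst e * (c35 * (L : ℝ) ^ i.m * α₀) * ((((L ^ i.kk : ℕ) : ℝ))⁻¹) +
      KD * ((((L ^ i.kk : ℕ) : ℝ)) ^ (-(1 / 16 : ℝ))) + KD * ((((L ^ i.kk : ℕ) : ℝ)) ^ (-(1 / 16 : ℝ)))) + ((L ^ i.kk : ℕ) : ℝ)⁻¹)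
      ≤ (C * (Kz * (2 + 2 * KD) + 1) + 1) * t := by
    rw [hθt]
    have h2 : basisConst e * (c35 * (L : ℝ) ^ i.m * α₀) * ((((L ^ i.kk : ℕ) : ℝ))⁻¹) ≤ t := by
      calc basisConst e * (c35 * (L : ℝ) ^ i.m * α₀) * ((((L ^ i.kk : ℕ) : ℝ))⁻¹) ≤ 1 * t := mul_le_mul hκr1 hinv hη0 zero_le_one
        _ = t := one_mul t
    have h4 : Kz * (t + basisConst e * (c35 * (L : ℝ) ^ i.m * α₀) * ((((L ^ i.kk : ℕ) : ℝ))⁻¹) + KD * t + KD * t) ≤ Kz * (t + t + KD * t + KD * t) :=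
      mul_le_mul_of_nonneg_left (by linarith) hKz.le
    calc C * (Kz * (t + basisConst e * (c35 * (L : ℝ) ^ i.m * α₀) * ((((L ^ i.kk : ℕ) : ℝ))⁻¹) + KD * t + KD * t) + ((L ^ i.kk : ℕ) : ℝ)⁻¹) ≤ C * (Kz * (t + t + KD * t + KD * t) + t) :=
          mul_le_mul_of_nonneg_left (add_le_add h4 hinv) hC.le
      _ = (C * (Kz * (2 + 2 * KD) + 1)) * t := by ring
      _ ≤ (C * (Kz * (2 + 2 * KD) + 1) + 1) * t := mul_le_mul_of_nonneg_right (by linarith) ht0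
  calc _ ≤ C * (Kz * ((((L ^ i.kk : ℕ) : ℝ)) ^ (-(1 / 16 : ℝ)) + basisConst e * (c35 * (L : ℝ) ^ i.m * α₀) * ((((L ^ i.kk : ℕ) : ℝ))⁻¹) +
          KD * ((((L ^ i.kk : ℕ) : ℝ)) ^ (-(1 / 16 : ℝ))) + KD * ((((L ^ i.kk : ℕ) : ℝ)) ^ (-(1 / 16 : ℝ)))) + ((L ^ i.kk : ℕ) : ℝ)⁻¹) * Real.exp (-(δS * tdistT M y y')) := hS
    _ ≤ ((C * (Kz * (2 + 2 * KD) + 1) + 1) * t) * Real.exp (-(δS * tdistT M y y')) := mul_le_mul_of_nonneg_right hamp hE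
    _ = _ := by rw [ht_def]; ring


/-! ## §3 Non-vacuity of the displayed rows: the zero family -/

omit [DecidableEq mm] [DecidableEq ι] in
/-- ★ **THE ZERO PERTURBATION FAMILY MEETS THE DISPLAYED ROWS** (with `K_D = 0`, `s₀ = 1` at every rate): the hypothesis `hfam` of `ne2PlusSite_foSiteCov` is inhabited — by the flat averaging itself —
so the theorem is not vacuous; at that family the kernel is (J-c)'s (`foSiteCov_zero_family`). [bookkeeping] -/
theorem rows_zeroFamily (hL : Odd L ∧ 1 < L) (c35 : ℝ) : ∀ ρ : ℝ, 0 < ρ → ∃ KD s₀ : ℝ, 0 ≤ KD ∧ 0 < s₀ ∧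
      ∀ (i : SfIdx d L) (α₀ : ℝ) (A' : Fin (d + 1) → CvX' d L i.m i.kk i.r hL → Matrix mm mm ℂ), 0 < α₀ → c35 * (L : ℝ) ^ i.m * α₀ ≤ s₀ → (sfInstance d mm ι hL i).Bf.Reg335 c35 α₀ A' →
        HasMaj (CvNorm d L i.m i.kk hL ι) (BlockNorm.ofBlocks (unitTorusGeo L i.kk (cvM d L i.m i.kk hL)) (liftBlk (fun b : Tor (cvM d L i.m i.kk hL) × Fin (d + 1) => b.1) ι))
          ((fun (i : SfIdx d L) (_ : Fin (d + 1) → CvX' d L i.m i.kk i.r hL → Matrix mm mm ℂ) =>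
            (0 : (CvX d L i.m i.kk hL × ι → ℝ) →ₗ[ℝ] ((Tor (cvM d L i.m i.kk hL) × Fin (d + 1)) × ι → ℝ))) i A')
          (fun y y' => KD * (c35 * (L : ℝ) ^ i.m * α₀) * Real.exp (-(ρ * (unitTorusGeo L i.kk (cvM d L i.m i.kk hL)).dist y y'))) ∧
        HasMaj (BlockNorm.ofBlocks (unitTorusGeo L i.kk (cvM d L i.m i.kk hL)) (liftBlk (fun b : CvX' d L i.m i.kk i.r hL => blockOf (L ^ i.r * L ^ i.kk) (cvM d L i.m i.kk hL) b.1) ι))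
          (BlockNorm.ofBlocks (unitTorusGeo L i.kk (cvM d L i.m i.kk hL)) (liftBlk (fun b : Tor (cvM d L i.m i.kk hL) × Fin (d + 1) => b.1) ι))
          ((fun (i : SfIdx d L) (_ : Fin (d + 1) → CvX' d L i.m i.kk i.r hL → Matrix mm mm ℂ) =>
            (0 : (CvX' d L i.m i.kk i.r hL × ι → ℝ) →ₗ[ℝ] ((Tor (cvM d L i.m i.kk hL) × Fin (d + 1)) × ι → ℝ))) i A')
          (fun y y' => KD * (c35 * (L : ℝ) ^ i.m * α₀) * Real.exp (-(ρ * (unitTorusGeo L i.kk (cvM d L i.m i.kk hL)).dist y y'))) ∧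
        HasMaj (BlockNorm.ofBlocks (unitTorusGeo L i.kk (cvM d L i.m i.kk hL)) (liftBlk (fun b : Tor (cvM d L i.m i.kk hL) × Fin (d + 1) => b.1) ι)) (CvNorm d L i.m i.kk hL ι)
          ((fun (i : SfIdx d L) (_ : Fin (d + 1) → CvX' d L i.m i.kk i.r hL → Matrix mm mm ℂ) =>
            (0 : ((Tor (cvM d L i.m i.kk hL) × Fin (d + 1)) × ι → ℝ) →ₗ[ℝ] (CvX d L i.m i.kk hL × ι → ℝ))) i A')
          (fun y y' => KD * (c35 * (L : ℝ) ^ i.m * α₀) * Real.exp (-(ρ * (unitTorusGeo L i.kk (cvM d L i.m i.kk hL)).dist y y'))) ∧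
        HasMaj (BlockNorm.ofBlocks (unitTorusGeo L i.kk (cvM d L i.m i.kk hL)) (liftBlk (fun b : Tor (cvM d L i.m i.kk hL) × Fin (d + 1) => b.1) ι))
          (BlockNorm.ofBlocks (unitTorusGeo L i.kk (cvM d L i.m i.kk hL)) (liftBlk (fun b : CvX' d L i.m i.kk i.r hL => blockOf (L ^ i.r * L ^ i.kk) (cvM d L i.m i.kk hL) b.1) ι))
          ((fun (i : SfIdx d L) (_ : Fin (d + 1) → CvX' d L i.m i.kk i.r hL → Matrix mm mm ℂ) =>
            (0 : ((Tor (cvM d L i.m i.kk hL) × Fin (d + 1)) × ι → ℝ) →ₗ[ℝ] (CvX' d L i.m i.kk i.r hL × ι → ℝ))) i A')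
          (fun y y' => KD * (c35 * (L : ℝ) ^ i.m * α₀) * Real.exp (-(ρ * (unitTorusGeo L i.kk (cvM d L i.m i.kk hL)).dist y y'))) ∧
        HasMaj (CvNorm d L i.m i.kk hL ι) (BlockNorm.ofBlocks (unitTorusGeo L i.kk (cvM d L i.m i.kk hL)) (liftBlk (fun b : Tor (cvM d L i.m i.kk hL) × Fin (d + 1) => b.1) ι))
          ((fun (i : SfIdx d L) (_ : Fin (d + 1) → CvX' d L i.m i.kk i.r hL → Matrix mm mm ℂ) =>
              (0 : (CvX' d L i.m i.kk i.r hL × ι → ℝ) →ₗ[ℝ] ((Tor (cvM d L i.m i.kk hL) × Fin (d + 1)) × ι → ℝ))) i A' ∘ₗ pull (liftMap (kingPrV L i.kk i.r (cvM d L i.m i.kk hL)) ι) -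
            (fun (i : SfIdx d L) (_ : Fin (d + 1) → CvX' d L i.m i.kk i.r hL → Matrix mm mm ℂ) =>
              (0 : (CvX d L i.m i.kk hL × ι → ℝ) →ₗ[ℝ] ((Tor (cvM d L i.m i.kk hL) × Fin (d + 1)) × ι → ℝ))) i A')
          (fun y y' => KD * ((((L ^ i.kk : ℕ) : ℝ)) ^ (-(1 / 16 : ℝ))) * Real.exp (-(ρ * (unitTorusGeo L i.kk (cvM d L i.m i.kk hL)).dist y y'))) ∧
        HasMaj (BlockNorm.ofBlocks (unitTorusGeo L i.kk (cvM d L i.m i.kk hL)) (liftBlk (fun b : Tor (cvM d L i.m i.kk hL) × Fin (d + 1) => b.1) ι))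
          (BlockNorm.ofBlocks (unitTorusGeo L i.kk (cvM d L i.m i.kk hL)) (liftBlk (fun b : CvX' d L i.m i.kk i.r hL => blockOf (L ^ i.r * L ^ i.kk) (cvM d L i.m i.kk hL) b.1) ι))
          ((fun (i : SfIdx d L) (_ : Fin (d + 1) → CvX' d L i.m i.kk i.r hL → Matrix mm mm ℂ) =>
              (0 : ((Tor (cvM d L i.m i.kk hL) × Fin (d + 1)) × ι → ℝ) →ₗ[ℝ] (CvX' d L i.m i.kk i.r hL × ι → ℝ))) i A' -
            pull (liftMap (kingPrV L i.kk i.r (cvM d L i.m i.kk hL)) ι) ∘ₗ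
              (fun (i : SfIdx d L) (_ : Fin (d + 1) → CvX' d L i.m i.kk i.r hL → Matrix mm mm ℂ) =>
                (0 : ((Tor (cvM d L i.m i.kk hL) × Fin (d + 1)) × ι → ℝ) →ₗ[ℝ] (CvX d L i.m i.kk hL × ι → ℝ))) i A')
          (fun y y' => KD * ((((L ^ i.kk : ℕ) : ℝ)) ^ (-(1 / 16 : ℝ))) * Real.exp (-(ρ * (unitTorusGeo L i.kk (cvM d L i.m i.kk hL)).dist y y'))) := by
  intro ρ _
  refine ⟨0, 1, le_rfl, one_pos, fun i α₀ A' _ _ _ => ?_⟩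
  simp only [LinearMap.zero_comp, LinearMap.comp_zero, sub_zero, zero_mul]
  exact ⟨B11SectG.hasMaj_zero _ _, B11SectG.hasMaj_zero _ _, B11SectG.hasMaj_zero _ _, B11SectG.hasMaj_zero _ _, B11SectG.hasMaj_zero _ _, B11SectG.hasMaj_zero _ _⟩

/-- ★ **NON-VACUITY ∕ CONSISTENCY**: `ne2PlusSite_foSiteCov` at the zero family — the site layer for the flatly averaged kernel (pointwise (J-c)'s `foSiteSf`, `foSiteCov_zero_family`) — is a
member of the theorem's range; nothing in §2 is void. [bookkeeping] -/
theorem ne2PlusSite_foSiteCov_zeroFamily [Nonempty ι] (hL : Odd L ∧ 1 < L) (hL7 : 7 ≤ L) (ha : 0 < a) {c35 : ℝ} (hc35 : 0 < c35)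
    (he : ∀ A B : Matrix mm mm ℂ, traceForm A B = e A ⬝ᵥ e B) (α β : Fin (d + 1)) (j j' : ι) (d' : ℕ) (p : ℝ) :
    NE2PlusSite d' p c35 (sfInstance d mm ι hL) (foSiteCov d mm ι a e hL α β j j' (fun _ _ => 0) (fun _ _ => 0) (fun _ _ => 0) (fun _ _ => 0)) :=
  ne2PlusSite_foSiteCov d mm ι a e hL hL7 ha hc35 he α β j j' d' p _ _ _ _ (rows_zeroFamily d mm ι hL c35)

end SiteLayer

end Summit.QuantumFields.YangMills.BalabanUVNodes.N15.SiteLayerSf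

end
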